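import Summits.BirchSwinnertonDyer.BirchSwinnertonDyer.Theorems.GoldfeldAllTwistsTwoConverseTwinQuarterTraceIndexB4POne
import Summits.BirchSwinnertonDyer.BirchSwinnertonDyer.Theorems.GoldfeldAllTwistsTwoConverseTwinAdditiveTwoPrimesTwistDescentSharpPOne
import HarnessLib

set_option linter.dupNamespace false -- namespace `…BirchSwinnertonDyer.BirchSwinnertonDyer…` is the cell's (D-0017 nested layout)
set_option autoImplicit false

/-!
# Cell C7 (β, `q ≡ 7 (8)`, `p ≡ 1 (8)`, `(p/q) = −1`), ORDER «C7 −hCT» file 3: the G5 twin WITHOUT Cassels–Tate —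
# `bsdp_two_negTwoPrimesTwist_betaPOne_of_print_sharp : BSDp W 2` for every globally minimal `W ≅ 49a1^{(−2qp)}` on C7, FIFTEEN named inputs

Cell `bsd-goldfeld`, seat `bsd-goldfeld-s1p-c3x` (gen 13); planner RULING (ccclx), ORDER «C7 −hCT» (≤ 3 sibling files; no in-place edit of G5 p662363,
which stays landed and is DOMINATED by this file). `--supports stmt-BirchSwinnertonDyer-19140` as a HELPER. Theses-free; theorems only; no definition, no
new fact, no `sorry`. FRONTIER-grade: a twist-density-ZERO two-parameter cell modulo named print; never distance-to-summit.

WHAT CHANGES vs G5 (`…TwinQuarterTraceIndexB4POne`): the single line that consumed `hCT` — F11′'s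
`forall_mem_sha_two_smul_eq_zero_twoPrimesTwist_betaPOne_of_print` (`Ш(W)[2] = 0` from the (4,4) bound + Cassels–Tate) — is replaced by the SHARP
descent `rank_le_one_and_sha_two_twoPrimesTwist_pOne` (file 2: `#S ≤ 2` by the `2`-adic kill of the classes `2, 14`, `#S′ ≤ 4`, rank one ⇒ `Ш(W)[2] = 0`,
fact-free). Everything else is G5 verbatim. TOP-LEVEL BINDERS of the closer: `hCST hGZ h12 h44 h13 h14 hS31 hnew hM hBF hGZK` (the eleven C7 rank-axis
prints) + `hEta hEta₀ hD` + `hKo` = FIFTEEN; NO `hCT`, NO `hBT`.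
HONEST FRAMING: BSD(W,2) for a density-zero cell modulo named print; twin″ (item 19140) is NOT closed; BSD is not proved by any of this.

References: [Miller2011LMS] Def. 1.1; [GrossZagier1986] Thm. I.(6.3), V.§2; [GrossLMS1991] §4 (4.1); [CoatesLiTianZhai2015] Thm. 1.2–1.4, 4.4;
[BurungaleFlach2024] Cor. 2; [SilvermanAEC2009] Thm. X.4.2, X.4.9.
-/

noncomputable section

open scoped Classical IntermediateField

open WeierstrassCurve NumberField Literature.NumberTheory Literature.NumberTheory.EllipticCurves
  Literature.NumberTheory.EllipticCurves.ModularForms Literature.NumberTheory.EllipticCurves.CaiShuTian2014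
  Literature.NumberTheory.EllipticCurves.CoatesLiTianZhai2015 WeierstrassCurve.QuadraticDescent
  Summit.BirchSwinnertonDyer.Rank1Residual.P2

namespace Summit.BirchSwinnertonDyer.BirchSwinnertonDyer.Theorems.GoldfeldGoodTwists

/-! ## §1 The common road and the closer on C7, without Cassels–Tate -/

section Closers
-- the cell's point-group world over `K[1]` / `ℂ` (A2a″'s, X1's, X5's); section-local. No `omega`/`decide` below (helpers of §0 instead).
attribute [local instance 2000] Classical.propDecidable

/-- **THE COMMON ROAD OF THEOREM B⁗ ON CELL C7, WITHOUT CASSELS–TATE** (prints: `hGZ h12 hnew hBF hKo hGZK hM` only — the five prints `hCST h44 h13 h14 hS31`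
that G5's road carried solely for F11′ are gone with `hCT`). `W` globally minimal with `C • W = X₀(49)^{(−2qp)}`, `q ≡ 7 (mod 8)` prime, `(q/7) = −1`, `p ≡ 1 (mod 8)` prime,
`(−7/p) = 1`, `−7` a fourth power mod `p`, `(p/q) = −1` (`hq8 hq7 hp8 hp7 hβ hpq`),
`r_an(W) = rank W(ℚ) = 1`, and halving-exactly-once for the explicit trace over every imaginary quadratic `K` with `d_K = −8qp` (`htrace`, the
shape of the T3-I trace re-export) ⇒ `BSD(W, 2)`: the SHARP descent (`…TwinAdditiveTwoPrimesTwistDescentSharpPOne`: `Ш(W)[2] = 0` from `#S ≤ 2`, `#S′ ≤ 4`, rank `1` — fact-free, NO `hCT`) ⇒ `BSD(W,2) ⟺ ord₂ #Ш_an = 0`; `K = ℚ(√−2qp)`, a Heegner point (`hnew`),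
`Cd • X₀(49)^{(d_K)} = W`; `#Ш_an = 𝔮₄₉` with ITS `k`, `k = 1` (F12a); the optimal datum (`hM`), the trace relation, the factor table.
[cite: Miller2011LMS, Def. 1.1] [cite: GrossZagier1986, Thm. I.(6.3) and V.§2] [cite: BurungaleFlach2024, Cor. 2] [cite: GrossLMS1991, §4 (4.1)] -/
theorem bsdp_two_negTwoPrimesTwist_of_traceHalving_pOne_sharp
    (hGZ : ∀ (N : ℕ) [NeZero N] (W : WeierstrassCurve ℚ) (K : Type) [Field K] [NumberField K], gross_zagier N W K)
    (h12 : thm12_fullBSD_twist) (hnew : exists_isNewformOf) (hBF : bsdTriple_of_hasCM_of_L_one_ne_zero)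
    (hKo : ∀ (N : ℕ) [NeZero N] (W : WeierstrassCurve ℚ) (K : Type) [Field K] [NumberField K], kolyvagin N W K)
    (hGZK : rank_eq_analyticRank_of_analyticRank_le_one) (hM : OptimalCurveManinCertificate cm7)
    {q p : ℕ} [Fact q.Prime] [Fact p.Prime] (hq8 : q % 8 = 7) (hq7 : jacobiSym q 7 = -1) (hp8 : p % 8 = 1) (hp7 : legendreSym p (-7) = 1)
    (hβ : ∃ x : ZMod p, x ^ 4 = -7) (hpq : jacobiSym p q = -1)
    (W : WeierstrassCurve ℚ) [W.IsElliptic] [W.IsGloballyMinimal] (C : VariableChange ℚ)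
    (hC : C • W = cm7.quadraticTwist ((-2 * ((q : ℤ) * p) : ℤ) : ℚ)) (har : W.analyticRank = 1) (hrk : W.mordellWeilRank = 1)
    (htrace : ∀ (K : Type) [Field K] [NumberField K], IsImaginaryQuadratic K → NumberField.discr K = -(8 * (q : ℤ) * p) →
      ∀ (ι : K →+* ℂ) [FiniteDimensional K (ringClassField K ι 1)] [IsGalois K (ringClassField K ι 1)]
        (D₀ : ModularParametrizationData cm7 49), |D₀.c| = 1 → ∀ (β : ℤ) (d : KolyvaginHeegnerData D₀ β ι 1),
        ∃ y : (cm7.baseChange K).toAffine.Point,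
          Affine.Point.map (W' := cm7) (algebraMap K (ringClassField K ι 1)).toRatAlgHom y =
            ∑ σ : ringClassField K ι 1 ≃ₐ[K] ringClassField K ι 1,
              Affine.Point.map (σ : ringClassField K ι 1 →ₐ[K] ringClassField K ι 1) d.y ∧
          (∃ (N : ℤ) (R₀ : (cm7.baseChange K).toAffine.Point), Odd N ∧ N • y = (2 : ℤ) • R₀) ∧
          ¬ ∃ (S : (cm7.baseChange K).toAffine.Point) (N' : ℤ) (t' : (cm7.baseChange K).toAffine.Point), Odd N' ∧
              (t' = 0 ∨ t' = Affine.Point.some 2 (-1) (nonsingular_cm7_baseChange_two_neg_one K)) ∧ N' • y = (4 : ℤ) • S + t') :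
    BSDp W 2 := by
  haveI : cm7.IsGloballyMinimal := Summit.BirchSwinnertonDyer.Rank1Residual.X12.O11.RouteU.isGloballyMinimal_X049_eq
  have hq : q.Prime := Fact.out
  have hp : p.Prime := Fact.out
  obtain ⟨hq4, -⟩ := mod_eight_seven_arith hq8
  obtain ⟨-, hq2, -, -⟩ := mod_four_three_split hq4
  obtain ⟨hp2, -, hp7', hp4⟩ := aux_of_mod_eight_one hp8
  obtain ⟨-, hqp, -, -, -⟩ := arith_negEightTwoPrimes_modFour hq4 hp4
  obtain ⟨hodd, hneg⟩ := cells_arith_negEightTwoPrimes_pOne hq4 hp4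
  have hpj : jacobiSym p 7 = 1 := by rw [← legendreSym_neg_seven_eq_jacobiSym hp2]; exact hp7
  have hCq : C • W = cm7.quadraticTwist (-(2 * (q : ℚ) * p)) := by rw [hC]; push_cast; ring_nf
  have h2 : ∀ c ∈ W.sha, 2 • c = 0 → c = 0 := (rank_le_one_and_sha_two_twoPrimesTwist_pOne hq8 hq7 hp8 hp7 hpq W C hC).2 hrk
  obtain ⟨-, hiff⟩ := bsdp_two_iff_shaAn_unit_of_forall_mem_sha W h2 (hrk.trans har.symm)
  ------------------------------------------------------------------ `K = ℚ(√−2qp)`, a Heegner point, `Cd • X₀(49)^{(d_K)} = W`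
  have hsq : Squarefree (-(2 * ((q : ℤ) * p))) := squarefree_neg_two_mul_two_primes hq hp hq2 hp2 hqp
  obtain ⟨h4dvd, hmod4, hdiv⟩ := discr_arith_negEight_odd hodd
  obtain ⟨K, _, _, h2K, hdK⟩ := QuadraticFields.Quadratic.exists_numberField_discr_eq (D := 4 * (-(2 * ((q : ℤ) * p))))
    (Or.inr ⟨h4dvd, hmod4, by rw [hdiv]; exact hsq⟩)
  have hK : IsImaginaryQuadratic K := isImaginaryQuadratic_iff_discr_neg.mpr ⟨h2K, by rw [hdK]; exact hneg⟩
  have hdK' : NumberField.discr K = -(8 * (q : ℤ) * p) := by rw [hdK]; ring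
  have hdK8 : NumberField.discr K = -(8 * ((q * p : ℕ) : ℤ)) := by rw [hdK]; push_cast; ring
  haveI : NeZero (cm7.conductorNorm ℤ) := ⟨(cm7.conductorNorm_pos_holds).ne'⟩
  have hH : SatisfiesHeegnerHypothesis 49 K := satisfiesHeegnerHypothesis_fortyNine_negEightTwoPrimes hK hq7 hpj hdK'
  have hH' : SatisfiesHeegnerHypothesis (cm7.conductorNorm ℤ) K := by rw [conductorNorm_cm7]; exact hH
  obtain ⟨P, hP0⟩ := exists_isHeegnerPoint_of_exists_isNewformOf_of_maninConstant cm7 K hnew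
    IsNewformOf.exists_maninConstant_ne_zero_holds hK hH'
  obtain ⟨Dt, H, ι, hPH⟩ := isHeegnerPoint_of_level_eq conductorNorm_cm7 hP0
  obtain ⟨Cd, hCd⟩ := exists_smul_twist_discr_eq_of_smul_eq_twist_negTwo K hdK8 W C (by rw [hC]; push_cast; ring_nf)
  ------------------------------------------------------------------ `#Ш_an = 𝔮₄₉` with ITS `k`, and `k = 1`
  obtain ⟨-, hrK, -, k, hk12, hkiff, hsha⟩ := shaAn_eq_x049HeegnerTwistQuotient_of_heegner hnew h12 hBF hGZ hKo hGZK K hK hH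
    Dt H ι P hPH W Cd hCd har
  have hk1 : k = 1 := by
    rcases hk12 with h | h
    · exact h
    · exact absurd (hkiff.mp h) (not_forall_halvable_twoPrimesTwist_pOne hK hq8 hq7 hp8 hp7 hβ hpq hdK' W C hC hrk)
  rw [hk1] at hsha
  refine hiff.mpr ⟨_, hsha, ?_⟩
  ------------------------------------------------------------------ the trace of the optimal datum: `P = (D₀.c·Dt.c) • y`, `y` halved exactly once
  obtain ⟨hN, D, -, hD', -⟩ := hM.exists_optimalDatum_abs_maninConstant_eq_one
  haveI := hN
  obtain ⟨D₀, hc⟩ := exists_datum_abs_c_eq_one_of_level_eq conductorNorm_cm7 D hD'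
  obtain ⟨d⟩ := exists_kolyvaginHeegnerData_one (phi_heegnerTau_mem_singularModuliField_holds 49 cm7 K) hK D₀ H.β ι H.dvd_sq_sub
  obtain ⟨hfd, hgal⟩ := finiteDimensional_and_isGalois_ringClassField hK ι one_ne_zero
  haveI := hfd
  haveI := hgal
  obtain ⟨y, hy, hhalf, hno4⟩ := htrace K hK hdK' ι D₀ hc H.β d
  obtain ⟨-, htr⟩ := map_eq_zsmul_sum_algEquiv_of_abs_c_eq_one (heegnerPointOfConductor_one_galoisConj_holds 49 cm7 K) hK hH Dt
    D₀ hc H d hPH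
  rw [← hy, ← map_zsmul] at htr
  have hPy : P = (D₀.c * Dt.c) • y :=
    Affine.Point.map_injective (W' := cm7) (f := (algebraMap K (ringClassField K ι 1)).toRatAlgHom) htr
  exact padicValRat_x049Quotient_eq_zero_of_halvingExactlyOnce h12 hK hq hp hq2 hp2 hqp hp7' hq7 hpj hdK' Dt D₀ hc hPy hrK hhalf hno4
    W Cd hCd

/-- **`BSD(W, 2)` ON CELL C7, FROM PRINT + KOLYVAGIN — FIFTEEN named inputs, NO Cassels–Tate.** For primes `q ≡ 7 (mod 8)` with `(q/7) = −1`, `p ≡ 1 (mod 8)` with `(−7/p) = +1`,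
`−7` a fourth power mod `p`, `(p/q) = −1`, and EVERY globally minimal elliptic `W/ℚ` with `C • W = X₀(49)^{(−2qp)}`: **`BSD(W, 2)`** (Miller's
`2`-part), granted EXACTLY: the eleven prints of the C7 rank axis (`hCST hGZ h12 h44 h13 h14 hS31 hnew hM hBF hGZK`; F6b), (F-norm) `hEta`, (F-η) `hEta₀`, (F-D) `hD` (the trace re-export G34), and Kolyvagin `hKo` (the Gross–Zagier quotient);
NO Burungale–Tian. The road: rank axis ⇒ `r_an = rank = 1`; common road `bsdp_two_negTwoPrimesTwist_of_traceHalving_pOne_sharp` (`Ш(W)[2] = 0` by the sharp descent, not by Cassels–Tate)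
with the C7 trace re-export. This DOMINATES G5's `bsdp_two_negTwoPrimesTwist_betaPOne_of_print` (sixteen inputs, with `hCT`). Twist-density ZERO; twin″ (item 19140) is NOT closed; BSD is not proved by any of this; not in print (BCST 2022 Rem. D: even `d_K`).
[cite: Miller2011LMS, Def. 1.1] [cite: GrossZagier1986, Thm. I.(6.3) and V.§2] [cite: CoatesLiTianZhai2015, Thm. 1.2 (p. 359), 1.3, 1.4 and 4.4]
[cite: BurungaleCastellaSkinnerTian2022, Rem. D (p. 327)] [cite: SilvermanAEC2009, Thm. X.4.14] -/
theorem bsdp_two_negTwoPrimesTwist_betaPOne_of_print_sharp (hCST : thm11_ringClassChar)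
    (hGZ : ∀ (N : ℕ) [NeZero N] (W : WeierstrassCurve ℚ) (K : Type) [Field K] [NumberField K], gross_zagier N W K)
    (h12 : thm12_fullBSD_twist) (h44 : thm44_ord_two_LAlg) (h13 : thm13_ord_two_LAlg) (h14 : thm14_rankOne_twist)
    (hS31 : bsdTriple_of_rank_le_one_of_conductor_lt) (hnew : exists_isNewformOf) (hM : OptimalCurveManinCertificate cm7)
    (hBF : bsdTriple_of_hasCM_of_L_one_ne_zero) (hGZK : rank_eq_analyticRank_of_analyticRank_le_one)
    (hEta : x049_heegner_norm_x_sub_two_not_mem)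
    (hEta₀ : x049_x_sub_two_eq_etaQuotient) (hD : deuring_etaQuotient49_heegner_generates_conjPrime)
    (hKo : ∀ (N : ℕ) [NeZero N] (W : WeierstrassCurve ℚ) (K : Type) [Field K] [NumberField K], kolyvagin N W K)
    {q p : ℕ} (hq : q.Prime) (hq8 : q % 8 = 7) (hq7 : jacobiSym q 7 = -1)
    [Fact p.Prime] (hp8 : p % 8 = 1) (hp7 : legendreSym p (-7) = 1) (hβ : ∃ x : ZMod p, x ^ 4 = -7) (hpq : jacobiSym (p : ℤ) q = -1)
    (W : WeierstrassCurve ℚ) [W.IsElliptic] [W.IsGloballyMinimal] (C : VariableChange ℚ)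
    (hC : C • W = cm7.quadraticTwist (-(2 * (q : ℚ) * p))) : BSDp W 2 := by
  haveI := Fact.mk hq
  obtain ⟨har, hrk, -⟩ := analyticRank_eq_one_twoPrimesTwist_betaPOne_of_print hCST hGZ h12 h44 h13 h14 hS31 hnew hM hBF hGZK hq hq8 hq7
    hp8 hp7 hβ hpq W C hC
  have hC' : C • W = cm7.quadraticTwist ((-2 * ((q : ℤ) * p) : ℤ) : ℚ) := by rw [hC]; push_cast; ring_nf
  obtain ⟨hq4, h3⟩ := mod_eight_seven_arith hq8
  exact bsdp_two_negTwoPrimesTwist_of_traceHalving_pOne_sharp hGZ h12 hnew hBF hKo hGZK hM hq8 hq7 hp8 hp7 hβ hpq W C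
    hC' har hrk fun K _ _ hK hdK ι _ _ D₀ hc β d ↦ trace_halvingExactlyOnce_negEightTwoPrimes_betaPOne_of_print hCST hGZ h12 h44 h13 h14
      hS31 hnew hM hBF hGZK hEta hEta₀ hD hq h3 hq4 hq7 hp8 hp7 hβ hpq hK hdK ι D₀ hc d

end Closers

end Summit.BirchSwinnertonDyer.BirchSwinnertonDyer.Theorems.GoldfeldGoodTwists

end
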